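import Summits.HodgeConjecture.HodgeConjecture.Theorems.F0LD2ThetaTorusEigenclass
import Literature.RepresentationTheory.CompactGroups.CharProjEigenvector
import HarnessLib

/-!
# (Gβ2-ii-γ) The torus character projector on a Hermite theta class: `P_κ [θ_{h_β ⊗ Φ_f}]` is the class itself or zero
# (line LD1 of crux HLiu418, organ (Gβ) «theta slice», brick (Gβ2-ii) of LD1-plan (g2)'s blueprint — the (γ) half, over an ABSTRACT torus hom)

Cell hodgecm-mathlib, floor 0; namespace `Summit.HodgeConjecture.HodgeConjecture.Cruxes.HLiu418.F0LD1ThetaClassTorusCharProj`; seat LD1-p02 (g3);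
`--supports stmt-HodgeConjecture-24832 --as helper`.  THEOREMS ONLY (no definition, no `sorry`).

For a compact commutative topological group `T` (probability Haar `μT`) mapped into `U(H)(𝔸)` by a hom `k` whose image at each `t` is, through the
pinned transport `ιA`, the archimedean single `adelicSingle w₀ u_t` with `u_t = diag(s_t)` (`s̄ s = 1`) at the complex place `w₀` over a real place
`v₀` — the hypothesis shape `hk` of ★ `F0LD2ThetaTorusEigenclass.rightRegular_toLp_lineThetaLift_follandHermite_of_eq_adelicSingle` (the hom `k`
itself is brick (Gβ2-ii-α), not constructed here) — the `L²`-class of the theta lift of a Hermite pure tensor `h_β ⊗ Φ_f` is an EIGENVECTOR of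
`(rightRegular ν).restrict k` with eigencharacter `c(t) = ∏_p s_t(p)^{n_p}` (§1, ★ eigen-identity read through Mathlib `ContRepresentation.restrict`);
hence for a one-dimensional continuous unitary `κ : T → ℂ` the character projector `Schur.charProj μT κ` FIXES the class when `κ = c` and KILLS it
when `κ ≇ σ`, `σ = c` (§2, ★ `Schur.charProj_apply_of_forall_apply_eq_smul` ∕ `…_eq_zero_…`, p850551).  Nothing printed is discharged.
HC_CM is proved only modulo the 7 printed citations (2 remaining: hLiu418 = stmt-HodgeConjecture-24832, h413 = stmt-HodgeConjecture-24833) until rung 0 closes.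

References (prose locators, no cite tokens needed beyond the ★ files'): Konno–Konno 2007 Thm 5.4 (torus action on Hermite functions); Bröcker–tom Dieck
III (5.10) (character projectors); Borel–Jacquet 1979 §4.6.
-/

set_option autoImplicit false
set_option linter.dupNamespace false

noncomputable section

open NumberField NumberField.InfinitePlace MeasureTheory IsDedekindDomain
open scoped Matrix ComplexOrder ENNReal TensorProduct SchwartzMap Kronecker Classical ComplexConjugate InnerProductSpace

namespace Summit.HodgeConjecture.HodgeConjecture.Cruxes.HLiu418.F0LD1ThetaClassTorusCharProj

open _root_.MeasureTheory
open Literature.NumberTheory.Automorphic Literature.NumberTheory.Automorphic.UnitaryGroup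
open Literature.NumberTheory.Automorphic.UnitaryGroup.CotangentForms
open Literature.NumberTheory.Automorphic.IdeleClassGroup
open Literature.NumberTheory.Automorphic.Liu2021
open Literature.NumberTheory.Automorphic.Liu2021.Def411WeilCarriers
open Literature.NumberTheory.Automorphic.Liu2021.Def411WeilCarriersDoubling
open Literature.NumberTheory.Automorphic.Liu2021.CinfThetaTorus
open Literature.NumberTheory.GelbartRogawski1991 Literature.NumberTheory.GelbartRogawski1991.UnitaryDualPair
open Literature.NumberTheory.GelbartRogawski1991.GRConstruction
open Literature.NumberTheory.Weil1964
open Literature.RepresentationTheory.Liu2021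
open Literature.RepresentationTheory.HeisenbergGroup Literature.Analysis.SegalBargmann
open Literature.RepresentationTheory.KonnoKonno2007 Literature.RepresentationTheory.KonnoKonno2007.RealDualPair
open Literature.RepresentationTheory.CompactGroups
open Summit.HodgeConjecture.HodgeConjecture.Cruxes.HLiu418.F0LD1ThetaTransportKit
open Summit.HodgeConjecture.HodgeConjecture.Cruxes.HLiu418.F0LD2ThetaTensorClasses
open Summit.HodgeConjecture.HodgeConjecture.Cruxes.HLiu418.F0LD2ThetaTorusEigenclass


variable (L : Type) [Field L] [NumberField L] [IsCMField L] (N : ℕ) (H : Matrix (Fin N) (Fin N) L)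
  {n' : ℕ} (e₁ : Fin N × Fin 1 ≃ Fin n') (dV : Fin N → L) (hdV : ∀ i, IsCMField.complexConj L (dV i) = dV i)
  (hdV0 : ∀ i, dV i ≠ 0)
  (ιA : (adelicGroupData (↥(maximalRealSubfield L)) L (IsCMField.complexConj L) N H).Adelic →*
    ↥(UnitaryGroup.adelic (↥(maximalRealSubfield L)) L (IsCMField.complexConj L) N (Matrix.diagonal dV)))
  (hιA : Continuous ιA ∧ ∀ ⦃γ : (adelicGroupData (↥(maximalRealSubfield L)) L (IsCMField.complexConj L) N H).Adelic⦄,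
    γ ∈ (UnitaryGroup.toAdelic (↥(maximalRealSubfield L)) L (IsCMField.complexConj L) N H).range →
      ιA γ ∈ (UnitaryGroup.toAdelic (↥(maximalRealSubfield L)) L (IsCMField.complexConj L) N (Matrix.diagonal dV)).range)
  (μ : Literature.NumberTheory.Automorphic.IdeleClassGroup L →ₜ* Circle) (hμ : IsConjugateSymplectic L μ) (a : (↥(maximalRealSubfield L))ˣ)
  (hρ : HasThetaMajorants fun
      (p : ↥(UnitaryGroup.adelic (↥(maximalRealSubfield L)) L (IsCMField.complexConj L) N (Matrix.diagonal dV)) ×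
        ↥(UnitaryGroup.adelic (↥(maximalRealSubfield L)) L (IsCMField.complexConj L) 1 (JW (↥(maximalRealSubfield L)) L a)))
      (Φ : piSchwartzBruhat (↥(maximalRealSubfield L)) (Fin n')) =>
        pairRep (↥(maximalRealSubfield L)) L (IsCMField.complexConj L) N 1 e₁ (Matrix.diagonal dV) (JW (↥(maximalRealSubfield L)) L a)
          (chiSplittingLine L e₁ dV hdV hdV0 (toHeckeCharacter L μ) (isUnitary_toHeckeCharacter L μ)
            ((isOscillatorChar_toHeckeCharacter_iff μ).mpr hμ) (TW (↥(maximalRealSubfield L)) a)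
            (isUnit_det_TW (↥(maximalRealSubfield L)) a) (JW (↥(maximalRealSubfield L)) L a) (JW_eq (↥(maximalRealSubfield L)) L a))
          p Φ)
  [CompactSpace (↥(UnitaryGroup.adelic (↥(maximalRealSubfield L)) L (IsCMField.complexConj L) N (Matrix.diagonal dV)) ⧸
    (UnitaryGroup.toAdelic (↥(maximalRealSubfield L)) L (IsCMField.complexConj L) N (Matrix.diagonal dV)).range)]
  [MeasurableSpace (↥(UnitaryGroup.adelic (↥(maximalRealSubfield L)) L (IsCMField.complexConj L) 1 (JW (↥(maximalRealSubfield L)) L a)) ⧸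
    (UnitaryGroup.toAdelic (↥(maximalRealSubfield L)) L (IsCMField.complexConj L) 1 (JW (↥(maximalRealSubfield L)) L a)).range)]
  (μW : Measure (↥(UnitaryGroup.adelic (↥(maximalRealSubfield L)) L (IsCMField.complexConj L) 1 (JW (↥(maximalRealSubfield L)) L a)) ⧸
    (UnitaryGroup.toAdelic (↥(maximalRealSubfield L)) L (IsCMField.complexConj L) 1 (JW (↥(maximalRealSubfield L)) L a)).range))
  (f : C((↥(UnitaryGroup.adelic (↥(maximalRealSubfield L)) L (IsCMField.complexConj L) 1 (JW (↥(maximalRealSubfield L)) L a)) ⧸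
    (UnitaryGroup.toAdelic (↥(maximalRealSubfield L)) L (IsCMField.complexConj L) 1 (JW (↥(maximalRealSubfield L)) L a)).range), ℂ))
  [BorelSpace (↥(UnitaryGroup.adelic (↥(maximalRealSubfield L)) L (IsCMField.complexConj L) 1 (JW (↥(maximalRealSubfield L)) L a)) ⧸
    (UnitaryGroup.toAdelic (↥(maximalRealSubfield L)) L (IsCMField.complexConj L) 1 (JW (↥(maximalRealSubfield L)) L a)).range)]
  [IsFiniteMeasure μW]
  [CompactSpace (adelicGroupData (↥(maximalRealSubfield L)) L (IsCMField.complexConj L) N H).automorphicQuotient]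
  (ν : Measure (adelicGroupData (↥(maximalRealSubfield L)) L (IsCMField.complexConj L) N H).automorphicQuotient) [IsFiniteMeasure ν]
  [SMulInvariantMeasure (adelicGroupData (↥(maximalRealSubfield L)) L (IsCMField.complexConj L) N H).Adelic
    (adelicGroupData (↥(maximalRealSubfield L)) L (IsCMField.complexConj L) N H).automorphicQuotient ν]


include hιA

set_option maxHeartbeats 400000 in
/-- **§1 The Hermite theta class is a `k`-EIGENVECTOR**: for every `t ∈ T`, `((rightRegular ν).restrict k) t [θ_{h_β ⊗ Φ_f}] = c(t) • [θ_{h_β ⊗ Φ_f}]`,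
`c(t) = ∏_p s_t(p)^{n_p}` (★ `rightRegular_toLp_lineThetaLift_follandHermite_of_eq_adelicSingle` at `k t`, read through `ContRepresentation.restrict`).
[cite: KonnoKonno2007, Thm. 5.4] [cite: BorelJacquet1979, §4.6] -/
theorem restrict_rightRegular_apply_thetaClass_follandHermite
    (v₀ : {v : InfinitePlace (↥(maximalRealSubfield L)) // v.IsReal})
    {τ : InfinitePlace L → ℤ} (hτ : (toHeckeCharacter L μ).HasUnitaryArchType τ 0) (hodd : ∀ w, Odd (τ w))
    (β : (Fin n' × {v : InfinitePlace (↥(maximalRealSubfield L)) // v.IsReal}) →₀ ℕ) (Φf : FinSB (↥(maximalRealSubfield L)) (Fin n'))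
    {T : Type} [CommGroup T] [TopologicalSpace T] [IsTopologicalGroup T] [CompactSpace T] [MeasurableSpace T] [BorelSpace T]
    (μT : Measure T) [IsProbabilityMeasure μT] [μT.IsMulLeftInvariant]
    (k : T →* (adelicGroupData (↥(maximalRealSubfield L)) L (IsCMField.complexConj L) N H).Adelic)
    (s : T → Fin N → ℂ) (hs : ∀ t p, star (s t p) * s t p = 1)
    (u : T → UnitaryGroup.archLocal L N (Matrix.diagonal dV) (cmPlaceOver L v₀))
    (hu : ∀ t, (((u t : UnitaryGroup.archLocal L N (Matrix.diagonal dV) (cmPlaceOver L v₀)) : GL (Fin N) ℂ) : Matrix (Fin N) (Fin N) ℂ) = Matrix.diagonal (s t))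
    (hk : ∀ t, ιA (k t) = UnitaryGroup.adelicSingle (↥(maximalRealSubfield L)) L (IsCMField.complexConj L) N (Matrix.diagonal dV) (IsCMField.complexConj_ne_one L)
      (complexConj_smul_infinitePlace L) (cmPlaceOver L v₀) (u t)) (t : T) :
    (((adelicGroupData (↥(maximalRealSubfield L)) L (IsCMField.complexConj L) N H).rightRegular ν).restrict k) t
        (MemLp.toLp _ (memLp_toQuotFun_lineThetaLift L N H e₁ dV hdV hdV0 ιA hιA μ hμ a hρ μW
          (piSchwartzBruhatEquiv (↥(maximalRealSubfield L)) (Fin n')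
            (follandHermite (frameV L e₁ dV hdV hdV0 (lineW L (TW (Fp L) a)) (complexConj_lineW L (TW (Fp L) a))
              (lineW_ne_zero L (TW (Fp L) a) (isUnit_det_TW (Fp L) a))) β ⊗ₜ Φf)) f ν 2)) =
      (∏ p : Fin N, s t p ^ (if 0 < signVec (cmPlaceOver L) (cmGramEntry L e₁ dV hdV (lineW L (TW (Fp L) a)) (complexConj_lineW L (TW (Fp L) a))) (imagUnit L) v₀ (e₁ (p, 0))
        then (τ (cmPlaceOver L v₀).1 + 1) / 2 + β (e₁ (p, 0), v₀)
        else (τ (cmPlaceOver L v₀).1 + 1) / 2 - 1 - β (e₁ (p, 0), v₀))) • (MemLp.toLp _ (memLp_toQuotFun_lineThetaLift L N H e₁ dV hdV hdV0 ιA hιA μ hμ a hρ μW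
          (piSchwartzBruhatEquiv (↥(maximalRealSubfield L)) (Fin n')
            (follandHermite (frameV L e₁ dV hdV hdV0 (lineW L (TW (Fp L) a)) (complexConj_lineW L (TW (Fp L) a))
              (lineW_ne_zero L (TW (Fp L) a) (isUnit_det_TW (Fp L) a))) β ⊗ₜ Φf)) f ν 2)) := by
  rw [ContRepresentation.restrict_apply]
  exact rightRegular_toLp_lineThetaLift_follandHermite_of_eq_adelicSingle L N H e₁ dV hdV hdV0 ιA hιA μ hμ a hρ μW f ν v₀ hτ hodd
    (s t) (hs t) (u t) (hu t) (k t) (hk t) β Φf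

/-- **§2 (γ1) The torus projector of the EIGEN-type FIXES the Hermite theta class**: for a one-dimensional continuous unitary irreducible `κ` of `T`
with `κ t 1 = c(t)`, `Schur.charProj μT κ ((rightRegular ν).restrict k) [θ_{h_β ⊗ Φ_f}] = [θ_{h_β ⊗ Φ_f}]` (★ p850551 + §1).
[cite: BrockerTomDieck1985, III (5.10)] [cite: KonnoKonno2007, Thm. 5.4] -/
theorem charProj_thetaClass_follandHermite_eq_self
    (v₀ : {v : InfinitePlace (↥(maximalRealSubfield L)) // v.IsReal})
    {τ : InfinitePlace L → ℤ} (hτ : (toHeckeCharacter L μ).HasUnitaryArchType τ 0) (hodd : ∀ w, Odd (τ w))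
    (β : (Fin n' × {v : InfinitePlace (↥(maximalRealSubfield L)) // v.IsReal}) →₀ ℕ) (Φf : FinSB (↥(maximalRealSubfield L)) (Fin n'))
    {T : Type} [CommGroup T] [TopologicalSpace T] [IsTopologicalGroup T] [CompactSpace T] [MeasurableSpace T] [BorelSpace T]
    (μT : Measure T) [IsProbabilityMeasure μT] [μT.IsMulLeftInvariant]
    (k : T →* (adelicGroupData (↥(maximalRealSubfield L)) L (IsCMField.complexConj L) N H).Adelic)
    (s : T → Fin N → ℂ) (hs : ∀ t p, star (s t p) * s t p = 1)
    (u : T → UnitaryGroup.archLocal L N (Matrix.diagonal dV) (cmPlaceOver L v₀))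
    (hu : ∀ t, (((u t : UnitaryGroup.archLocal L N (Matrix.diagonal dV) (cmPlaceOver L v₀)) : GL (Fin N) ℂ) : Matrix (Fin N) (Fin N) ℂ) = Matrix.diagonal (s t))
    (hk : ∀ t, ιA (k t) = UnitaryGroup.adelicSingle (↥(maximalRealSubfield L)) L (IsCMField.complexConj L) N (Matrix.diagonal dV) (IsCMField.complexConj_ne_one L)
      (complexConj_smul_infinitePlace L) (cmPlaceOver L v₀) (u t))
    {κ : ContRepresentation ℂ T ℂ} (hκ : Continuous (κ : T → ℂ →L[ℂ] ℂ)) [κ.toRepresentation.IsIrreducible]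
    (hκu : ∀ (g : T) (z w : ℂ), ⟪κ g z, κ g w⟫_ℂ = ⟪z, w⟫_ℂ)
    (hκc : ∀ t, κ t 1 = (∏ p : Fin N, s t p ^ (if 0 < signVec (cmPlaceOver L) (cmGramEntry L e₁ dV hdV (lineW L (TW (Fp L) a)) (complexConj_lineW L (TW (Fp L) a))) (imagUnit L) v₀ (e₁ (p, 0))
        then (τ (cmPlaceOver L v₀).1 + 1) / 2 + β (e₁ (p, 0), v₀)
        else (τ (cmPlaceOver L v₀).1 + 1) / 2 - 1 - β (e₁ (p, 0), v₀)))) :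
    Schur.charProj μT κ (((adelicGroupData (↥(maximalRealSubfield L)) L (IsCMField.complexConj L) N H).rightRegular ν).restrict k)
        (MemLp.toLp _ (memLp_toQuotFun_lineThetaLift L N H e₁ dV hdV hdV0 ιA hιA μ hμ a hρ μW
          (piSchwartzBruhatEquiv (↥(maximalRealSubfield L)) (Fin n')
            (follandHermite (frameV L e₁ dV hdV hdV0 (lineW L (TW (Fp L) a)) (complexConj_lineW L (TW (Fp L) a))
              (lineW_ne_zero L (TW (Fp L) a) (isUnit_det_TW (Fp L) a))) β ⊗ₜ Φf)) f ν 2)) = (MemLp.toLp _ (memLp_toQuotFun_lineThetaLift L N H e₁ dV hdV hdV0 ιA hιA μ hμ a hρ μW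
          (piSchwartzBruhatEquiv (↥(maximalRealSubfield L)) (Fin n')
            (follandHermite (frameV L e₁ dV hdV hdV0 (lineW L (TW (Fp L) a)) (complexConj_lineW L (TW (Fp L) a))
              (lineW_ne_zero L (TW (Fp L) a) (isUnit_det_TW (Fp L) a))) β ⊗ₜ Φf)) f ν 2)) :=
  Schur.charProj_apply_of_forall_apply_eq_smul μT hκ hκu _ fun t => by
    rw [hκc t]
    exact restrict_rightRegular_apply_thetaClass_follandHermite L N H e₁ dV hdV hdV0 ιA hιA μ hμ a hρ μW f ν v₀ hτ hodd β Φf μT k s hs u hu hk t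

/-- **§2 (γ2) The torus projector of ANY OTHER type KILLS the Hermite theta class**: for one-dimensional continuous `κ ≇ σ` (`κ` unitary) with
`σ t 1 = c(t)`, `Schur.charProj μT κ ((rightRegular ν).restrict k) [θ_{h_β ⊗ Φ_f}] = 0` (★ p850551 + §1).
[cite: BrockerTomDieck1985, III (5.10); II (4.6)] [cite: KonnoKonno2007, Thm. 5.4] -/
theorem charProj_thetaClass_follandHermite_eq_zero
    (v₀ : {v : InfinitePlace (↥(maximalRealSubfield L)) // v.IsReal})
    {τ : InfinitePlace L → ℤ} (hτ : (toHeckeCharacter L μ).HasUnitaryArchType τ 0) (hodd : ∀ w, Odd (τ w))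
    (β : (Fin n' × {v : InfinitePlace (↥(maximalRealSubfield L)) // v.IsReal}) →₀ ℕ) (Φf : FinSB (↥(maximalRealSubfield L)) (Fin n'))
    {T : Type} [CommGroup T] [TopologicalSpace T] [IsTopologicalGroup T] [CompactSpace T] [MeasurableSpace T] [BorelSpace T]
    (μT : Measure T) [IsProbabilityMeasure μT] [μT.IsMulLeftInvariant]
    (k : T →* (adelicGroupData (↥(maximalRealSubfield L)) L (IsCMField.complexConj L) N H).Adelic)
    (s : T → Fin N → ℂ) (hs : ∀ t p, star (s t p) * s t p = 1)
    (u : T → UnitaryGroup.archLocal L N (Matrix.diagonal dV) (cmPlaceOver L v₀))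
    (hu : ∀ t, (((u t : UnitaryGroup.archLocal L N (Matrix.diagonal dV) (cmPlaceOver L v₀)) : GL (Fin N) ℂ) : Matrix (Fin N) (Fin N) ℂ) = Matrix.diagonal (s t))
    (hk : ∀ t, ιA (k t) = UnitaryGroup.adelicSingle (↥(maximalRealSubfield L)) L (IsCMField.complexConj L) N (Matrix.diagonal dV) (IsCMField.complexConj_ne_one L)
      (complexConj_smul_infinitePlace L) (cmPlaceOver L v₀) (u t))
    {κ σ : ContRepresentation ℂ T ℂ} (hκ : Continuous (κ : T → ℂ →L[ℂ] ℂ)) (hσ : Continuous (σ : T → ℂ →L[ℂ] ℂ))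
    [κ.toRepresentation.IsIrreducible] [σ.toRepresentation.IsIrreducible]
    (hne : IsEmpty (κ.toRepresentation.Equiv σ.toRepresentation))
    (hκu : ∀ (g : T) (z w : ℂ), ⟪κ g z, κ g w⟫_ℂ = ⟪z, w⟫_ℂ)
    (hσc : ∀ t, σ t 1 = (∏ p : Fin N, s t p ^ (if 0 < signVec (cmPlaceOver L) (cmGramEntry L e₁ dV hdV (lineW L (TW (Fp L) a)) (complexConj_lineW L (TW (Fp L) a))) (imagUnit L) v₀ (e₁ (p, 0))
        then (τ (cmPlaceOver L v₀).1 + 1) / 2 + β (e₁ (p, 0), v₀)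
        else (τ (cmPlaceOver L v₀).1 + 1) / 2 - 1 - β (e₁ (p, 0), v₀)))) :
    Schur.charProj μT κ (((adelicGroupData (↥(maximalRealSubfield L)) L (IsCMField.complexConj L) N H).rightRegular ν).restrict k)
        (MemLp.toLp _ (memLp_toQuotFun_lineThetaLift L N H e₁ dV hdV hdV0 ιA hιA μ hμ a hρ μW
          (piSchwartzBruhatEquiv (↥(maximalRealSubfield L)) (Fin n')
            (follandHermite (frameV L e₁ dV hdV hdV0 (lineW L (TW (Fp L) a)) (complexConj_lineW L (TW (Fp L) a))
              (lineW_ne_zero L (TW (Fp L) a) (isUnit_det_TW (Fp L) a))) β ⊗ₜ Φf)) f ν 2)) = 0 :=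
  Schur.charProj_apply_eq_zero_of_forall_apply_eq_smul μT hκ hσ hne hκu _ fun t => by
    rw [hσc t]
    exact restrict_rightRegular_apply_thetaClass_follandHermite L N H e₁ dV hdV hdV0 ιA hιA μ hμ a hρ μW f ν v₀ hτ hodd β Φf μT k s hs u hu hk t

end Summit.HodgeConjecture.HodgeConjecture.Cruxes.HLiu418.F0LD1ThetaClassTorusCharProj

end
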